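import Summits.HodgeConjecture.CorCM.Census.SexticOcticWeil
import HarnessLib

/-!
# `E × T × B` over a sextic and an octic CM field sharing `k`: THE DEFECT LAW from JOINT TRANSITIVITY of the realised pairs of
# permutations — `d₁ ≡ t₁`, `d₂ ≡ t₂`, `e = t₁ + 2 t₂`

COR-CM (cell `pub-hodgecm2`), seat b30 gen 26 (2026-08-23); count-neutral own lane SEXTIC-OCTIC, sequel of
`Census/SexticOcticWeil.lean` (model `PtS`, `phiS`, `ModelBalancedS`, the signed form).  One bookkeeping definition (`JointTransitive`)
and theorems of the finite model; no named fact, no geometry, no `sorry`, no `decide`.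

THE ARGUMENT.  Unknowns: the curve defect `e = N(τ) − N(τ̄)`, the threefold defects `d₁(a) = N(1,a,+) − N(1,a,−)` (`a < 3`), the
fourfold defects `d₂(b)` (`b < 4`).  The signed equation at a realised pair `π = (π₁, π₂)` reads
`e + (2 d₁(π₁⁻¹ 0) − Σ d₁) + (2 d₂(π₂⁻¹ 0) − Σ d₂) = 0` (`sum_ite_perm_eq`: a permutation takes the value `0` exactly once).  If `R`
is JOINTLY TRANSITIVE — for every `(x, y) ∈ Fin 3 × Fin 4` some `π ∈ R` has `π₁ x = 0` AND `π₂ y = 0` (`JointTransitive R`; downstream: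
automatic for a sextic and an octic field through `k`, whose totally real subfields have coprime degrees `3`, `4`) — then comparing the
equations at `(x, y)`, `(x', y)` and `(x, y')` gives `d₁ ≡ t₁`, `d₂ ≡ t₂` constant, and then `e = 3t₁ + 4t₂ − 2t₁ − 2t₂ = t₁ + 2t₂`:
**`defectS_of_signed_jointTransitive`**.  Conversely the defect law gives the signed equation at EVERY pair of permutations
(`signedS_of_defectS`), so the parts of the sequel are balanced under any `R` (`balancedS_of_defect`).  On configurations:
**`exists_defectS_of_modelBalancedS`**.  (Lattice form: the balanced lattice is `⟨conjugate pairs⟩ ⊕ ℤ(t₁ = 1: the Weil weight of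
`T × E`) ⊕ ℤ(t₂ = 1: the Weil weight of `B × E × E`)`; exact python `work/scratch/census68.py`: nullity `10 = 8 + 2`.)
[cite: Pohlmann1968, Thm 1] [cite: GaoUllmo2025, Thm 3.1] [cite: MoonenZarhin1995Duke, Thm. 2.4] [cite: DixonMortimer1996, §2.1]

## References
* [Pohlmann1968] H. Pohlmann, Ann. of Math. 88 (1968), Thm 1.  [GaoUllmo2025] Z. Gao, E. Ullmo, J. Inst. Math. Jussieu 25 (2025),
  Thm 3.1.  [MoonenZarhin1995Duke] B. Moonen, Yu. Zarhin, Duke Math. J. 77 (1995), Thm. 2.4.  [DixonMortimer1996] J. D. Dixon,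
  B. Mortimer, *Permutation Groups*, GTM 163, §2.1.
-/

namespace Summit.HodgeConjecture.CorCM.Census.SexticOcticWeil

open Finset

/-! ### Joint transitivity; the signed sum through a permutation -/

/-- **Joint transitivity** of a set of pairs of permutations on `Fin 3 × Fin 4`: every `(x, y)` is moved to `(0, 0)` by a member.
(For the realised pairs of a sextic and an octic CM field through `k` this is automatic — coprime relative degrees.)
[cite: DixonMortimer1996, §2.1] -/
def JointTransitive (R : Finset (Equiv.Perm (Fin 3) × Equiv.Perm (Fin 4))) : Prop :=
  ∀ (x : Fin 3) (y : Fin 4), ∃ π ∈ R, π.1 x = 0 ∧ π.2 y = 0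

/-- **A permutation takes the value `0` exactly once**: `Σ_a (σ a = 0 ? f a : −f a) = 2 f x − Σ f` when `σ x = 0`. [folklore] -/
theorem sum_ite_perm_eq {n : ℕ} [NeZero n] (σ : Equiv.Perm (Fin n)) {x : Fin n} (hx : σ x = 0) (f : Fin n → ℤ) :
    ∑ a : Fin n, (if σ a = 0 then f a else -f a) = 2 * f x - ∑ a : Fin n, f a := by
  have key : ∀ a : Fin n, (if σ a = 0 then f a else -f a) = (if a = x then 2 * f a else 0) - f a := by
    intro a
    by_cases h : a = x
    · subst h; rw [if_pos hx, if_pos rfl]; ring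
    · have h' : σ a ≠ 0 := fun h0 => h (σ.injective (h0.trans hx.symm))
      rw [if_neg h', if_neg h]; ring
  rw [Finset.sum_congr rfl fun a _ => key a, Finset.sum_sub_distrib, Finset.sum_ite_eq' Finset.univ x, if_pos (Finset.mem_univ x)]

/-! ### The defect law -/

section Defect

variable {R : Finset (Equiv.Perm (Fin 3) × Equiv.Perm (Fin 4))}

/-- **THE DEFECT LAW (integer form).**  If `e`, `d₁`, `d₂` satisfy the signed equation at every pair of a JOINTLY TRANSITIVE set `R`,
then `d₁ ≡ t₁`, `d₂ ≡ t₂` are constant and `e = t₁ + 2 t₂`. [cite: MoonenZarhin1995Duke, Thm. 2.4] [cite: GaoUllmo2025, Thm 3.1] -/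
theorem defectS_of_signed_jointTransitive (hjt : JointTransitive R) {e : ℤ} {d₁ : Fin 3 → ℤ} {d₂ : Fin 4 → ℤ}
    (h : ∀ π ∈ R, e + (∑ a : Fin 3, (if π.1 a = 0 then d₁ a else -d₁ a)) + (∑ b : Fin 4, (if π.2 b = 0 then d₂ b else -d₂ b)) = 0) :
    ∃ t₁ t₂ : ℤ, (∀ a, d₁ a = t₁) ∧ (∀ b, d₂ b = t₂) ∧ e = t₁ + 2 * t₂ := by
  -- the equation at `(x, y)`
  have heq : ∀ (x : Fin 3) (y : Fin 4), e + (2 * d₁ x - ∑ a, d₁ a) + (2 * d₂ y - ∑ b, d₂ b) = 0 := by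
    intro x y
    obtain ⟨π, hπ, hx, hy⟩ := hjt x y
    have h1 := h π hπ
    rwa [sum_ite_perm_eq π.1 hx d₁, sum_ite_perm_eq π.2 hy d₂] at h1
  refine ⟨d₁ 0, d₂ 0, fun a => ?_, fun b => ?_, ?_⟩
  · have h1 := heq a 0; have h2 := heq 0 0; omega
  · have h1 := heq 0 b; have h2 := heq 0 0; omega
  · have h1 : ∀ a, d₁ a = d₁ 0 := fun a => by have h1 := heq a 0; have h2 := heq 0 0; omega
    have h2 : ∀ b, d₂ b = d₂ 0 := fun b => by have h1 := heq 0 b; have h2 := heq 0 0; omega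
    have hs₁ : ∑ a, d₁ a = 3 * d₁ 0 := by
      rw [Finset.sum_congr rfl fun a _ => h1 a, Finset.sum_const, Finset.card_univ, Fintype.card_fin]; ring
    have hs₂ : ∑ b, d₂ b = 4 * d₂ 0 := by
      rw [Finset.sum_congr rfl fun b _ => h2 b, Finset.sum_const, Finset.card_univ, Fintype.card_fin]; ring
    have h3 := heq 0 0
    rw [hs₁, hs₂] at h3
    omega

/-- **Conversely, the defect law gives the signed equation at EVERY pair of permutations** (`2t₁ − 3t₁ + 2t₂ − 4t₂ = −(t₁ + 2t₂)`).
[folklore] -/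
theorem signedS_of_defectS {e t₁ t₂ : ℤ} {d₁ : Fin 3 → ℤ} {d₂ : Fin 4 → ℤ} (h₁ : ∀ a, d₁ a = t₁) (h₂ : ∀ b, d₂ b = t₂)
    (he : e = t₁ + 2 * t₂) (π : Equiv.Perm (Fin 3) × Equiv.Perm (Fin 4)) :
    e + (∑ a : Fin 3, (if π.1 a = 0 then d₁ a else -d₁ a)) + (∑ b : Fin 4, (if π.2 b = 0 then d₂ b else -d₂ b)) = 0 := by
  rw [sum_ite_perm_eq π.1 (π.1.apply_symm_apply 0) d₁, sum_ite_perm_eq π.2 (π.2.apply_symm_apply 0) d₂,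
    Finset.sum_congr rfl fun a _ => h₁ a, Finset.sum_congr rfl fun b _ => h₂ b, h₁, h₂, he, Finset.sum_const, Finset.sum_const,
    Finset.card_univ, Finset.card_univ, Fintype.card_fin, Fintype.card_fin]
  ring

end Defect

/-! ### The defect law for configurations -/

section Config

variable {α : Type*} {R : Finset (Equiv.Perm (Fin 3) × Equiv.Perm (Fin 4))} {v : α → PtS}

/-- **THE DEFECT LAW FOR CONFIGURATIONS.**  For an `R`-balanced configuration, `R` jointly transitive: the threefold counts have ONE
defect `t₁ = N(1,a,+) − N(1,a,−)` (all `a`), the fourfold counts ONE defect `t₂`, and the curve defect is `N(τ) − N(τ̄) = t₁ + 2t₂`.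
[cite: MoonenZarhin1995Duke, Thm. 2.4] [cite: GaoUllmo2025, Thm 3.1] -/
theorem exists_defectS_of_modelBalancedS (hjt : JointTransitive R) {T : Finset α} (hT : ModelBalancedS R v T) :
    ∃ t₁ t₂ : ℤ,
      (∀ a : Fin 3, ((T.filter fun x => v x = Sum.inr (Sum.inl (a, true))).card : ℤ) -
        (T.filter fun x => v x = Sum.inr (Sum.inl (a, false))).card = t₁) ∧
      (∀ b : Fin 4, ((T.filter fun x => v x = Sum.inr (Sum.inr (b, true))).card : ℤ) -
        (T.filter fun x => v x = Sum.inr (Sum.inr (b, false))).card = t₂) ∧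
      ((T.filter fun x => v x = Sum.inl true).card : ℤ) - (T.filter fun x => v x = Sum.inl false).card = t₁ + 2 * t₂ := by
  classical
  exact defectS_of_signed_jointTransitive hjt
    (d₁ := fun a => ((T.filter fun x => v x = Sum.inr (Sum.inl (a, true))).card : ℤ) -
      (T.filter fun x => v x = Sum.inr (Sum.inl (a, false))).card)
    (d₂ := fun b => ((T.filter fun x => v x = Sum.inr (Sum.inr (b, true))).card : ℤ) -
      (T.filter fun x => v x = Sum.inr (Sum.inr (b, false))).card)
    fun π hπ => signed_of_modelBalancedS R v hT hπ

/-- **A configuration obeying the defect law is balanced at EVERY pair of permutations** (so under any `R`). [folklore] -/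
theorem balancedS_of_defect {T : Finset α} {t₁ t₂ : ℤ}
    (h₁ : ∀ a : Fin 3, ((T.filter fun x => v x = Sum.inr (Sum.inl (a, true))).card : ℤ) -
      (T.filter fun x => v x = Sum.inr (Sum.inl (a, false))).card = t₁)
    (h₂ : ∀ b : Fin 4, ((T.filter fun x => v x = Sum.inr (Sum.inr (b, true))).card : ℤ) -
      (T.filter fun x => v x = Sum.inr (Sum.inr (b, false))).card = t₂)
    (he : ((T.filter fun x => v x = Sum.inl true).card : ℤ) - (T.filter fun x => v x = Sum.inl false).card = t₁ + 2 * t₂)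
    (π : Equiv.Perm (Fin 3) × Equiv.Perm (Fin 4)) :
    2 * (T.filter fun x => v x ∈ phiS π).card = T.card := by
  classical
  exact balancedS_of_signed v (signedS_of_defectS
    (d₁ := fun a => ((T.filter fun x => v x = Sum.inr (Sum.inl (a, true))).card : ℤ) -
      (T.filter fun x => v x = Sum.inr (Sum.inl (a, false))).card)
    (d₂ := fun b => ((T.filter fun x => v x = Sum.inr (Sum.inr (b, true))).card : ℤ) -
      (T.filter fun x => v x = Sum.inr (Sum.inr (b, false))).card) h₁ h₂ he π)

/-- **Balanced under a jointly transitive `R` ⟹ balanced under every set of pairs** (the defect law does not see `R`). [folklore] -/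
theorem ModelBalancedS.of_jointTransitive (hjt : JointTransitive R) {T : Finset α} (hT : ModelBalancedS R v T)
    (R' : Finset (Equiv.Perm (Fin 3) × Equiv.Perm (Fin 4))) : ModelBalancedS R' v T := by
  obtain ⟨t₁, t₂, h₁, h₂, he⟩ := exists_defectS_of_modelBalancedS hjt hT
  exact fun π _ => balancedS_of_defect h₁ h₂ he π

end Config

end Summit.HodgeConjecture.CorCM.Census.SexticOcticWeil
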